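import Literature.Analysis.Quadrature.KorobovClasses

/-!
# The squared worst-case error of a lattice rule in a weighted Korobov space: dual-lattice sum
# and Bernoulli-polynomial node sum (Dick–Pillichshammer 2014, §9.4.1, Theorem 15 and Remark 16;
# Lemieux 2009, eq. (5.29)–(5.30); Niederreiter 1992, Theorem 5.3)

Let `𝕋ᵈ = (ℝ/ℤ)ᵈ` with its Haar probability measure, let `P(g, N) = {({k g₁/N}, …, {k g_d/N}) :
0 ≤ k < N}` be the rank-1 lattice point set with generating vector `g ∈ ℤᵈ` (`latticeNode N g`,
`latticeRule N g` of `Literature.Analysis.Quadrature.LatticeRules`) and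
`L_{g,N} = {𝐡 ∈ ℤᵈ : 𝐡 · g ≡ 0 (mod N)}` its dual lattice (`dualLattice N g`).  For the smoothness
parameter `α` and *product weights* `γ = (γ_i)_i` put, following J. Dick and F. Pillichshammer,
*Discrepancy theory and quasi-Monte Carlo integration*, Chapter 9 of W. Chen, A. Srivastav,
G. Travaglini (eds.), *A Panorama of Discrepancy Theory*, Lecture Notes in Math. 2107, Springer
2014, §9.4.1 (p. 570),

  `r_{α,γ}(𝐡) = ∏_i r_{α,γ_i}(h_i)`, `r_{α,γ}(0) = 1`, `r_{α,γ}(h) = γ^{-1} |h|^α (h ≠ 0)`,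
  `ω_𝐡 = r_{α,γ}(𝐡)^{-1} = ∏_{i : h_i ≠ 0} γ_i / |h_i|^α`                    (`korobovWeight α γ 𝐡`).

We formalise, with complete proofs:

* **Theorem 15 (right-hand side) / Lemieux eq. (5.29).** Theorem 15 evaluates the squared
  worst-case error of the lattice rule in the weighted Korobov space as the dual-lattice sum
  `e²(H(K_{s,α,γ}); P(g, N)) = Σ_{𝐡 ∈ L_{g,N} ∖ {0}} ω_𝐡` [cite: DickPillichshammer2014, Thm. 15].
  We do not formalise the reproducing-kernel Hilbert space `H(K_Kor)` or the worst-case error as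
  a supremum over its unit ball; we work with the value given by Theorem 15, the series
  `Σ_{𝐡 ∈ L_{g,N} ∖ {0}} ω_𝐡` — which is also the *weighted `P_α`*
  `P̃_α = Σ_{0 ≠ 𝐡 ∈ L⊥} β_I ‖𝐡‖_π^{-α}` of C. Lemieux, *Monte Carlo and quasi-Monte Carlo
  sampling*, Springer 2009, eq. (5.29), for the product weights `β_I = β₀ ∏_{j ∈ I} β_j^α` with
  `β₀ = 1`, `γ_j = β_j^α` — as `weightedPFigure α γ g N`, a convergent series for `α ≥ 2`
  (`hasSum_weightedPFigure`); for `γ = (1, 1, …)` it is Niederreiter's `P_α(g, N)` (`pFigure`,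
  Niederreiter 1992, Def. 5.2): `pFigure_eq_weightedPFigure`.
* **Remark 16, first display.** For an even integer `α ≥ 2` the Bernoulli polynomial `B_α` has
  the Fourier expansion `B_α(x) = ((-1)^{(α+2)/2} α! / (2π)^α) Σ_{h ≠ 0} e^{2πihx} / |h|^α`,
  `x ∈ [0, 1)` [cite: DickPillichshammer2014, Rem. 16]: `hasSum_fourier_div_pow` (stated as
  `Σ_h e^{2πihx} / h^α = c_α B_α(x)` with `c_α = (-1)^{α/2+1} (2π)^α / α! = bernoulliCoeff α`, the
  reciprocal of the displayed constant; `h^α = |h|^α` as `α` is even, and the term `h = 0`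
  vanishes by the convention `1/0 = 0`).
* **Remark 16, second display / Lemieux eq. (5.30).** Hence, for even `α ≥ 2`,
  `e²(H(K_{s,α,γ}); P(g, N)) = -1 + (1/N) Σ_{k=0}^{N-1} ∏_{i=1}^{s} (1 + γ_i ((-1)^{(α+2)/2} (2π)^α
  / α!) B_α({k g_i / N}))` [cite: DickPillichshammer2014, Rem. 16], "so that `e²` can be
  calculated in `O(N s)` operations"; this is Lemieux's compact formulation (5.30)
  `P̃_α = β₀ {-1 + (1/n) Σ_{i=0}^{n-1} ∏_{j=1}^{s} [1 - (-β_j²)^{α/2} ((2π)^α/α!) B_α(u_{ij})]}`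
  [cite: Lemieux2009, eq. (5.30)]: `hasSum_korobovWeight_dualLattice`,
  `weightedPFigure_eq_bernoulli_sum` (nodes indexed by `ℤ/Nℤ`) and
  `weightedPFigure_eq_bernoulli_sum_range` (nodes indexed by `k = 0, …, N - 1`); for Niederreiter's
  `P_α(g, N)`: `pFigure_eq_bernoulli_sum`; and the case `α = 2`, `B₂(u) = u² - u + 1/6`, which is
  the criterion evaluated by component-by-component constructions in practice:
  `weightedPFigure_two`, `pFigure_two`.
* **Niederreiter 1992, Theorem 5.3 (attainment).** H. Niederreiter, *Random number generation and
  quasi-Monte Carlo methods*, SIAM 1992, Thm. 5.3: `max_{f ∈ E^s_α(C)} |Q_{N,g}(f) - ∫ f| =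
  C P_α(g, N)`; the inequality `≤` for every `f` is `norm_latticeRule_sub_integral_le_mul_pFigure`
  (file `KorobovClasses`), and here we formalise the attainment half of the proof — the special
  function `f₀ = C Σ_𝐡 r(𝐡)^{-α} e(𝐡 · u)` lies in `E^s_α(C)` and has error exactly `C P_α(g, N)`
  [cite: Niederreiter1992, Thm. 5.3] — for even integers `α ≥ 2`, where `f₀(u) = C ∏_i (1 + c_α
  B_α({u_i}))` in closed form: `exists_mem_korobovClass_latticeRule_sub_integral_eq`.

The proof is the one indicated in the sources: the function `f₀(x) = ∏_i (1 + γ_i c_α B̃_α(x_i))`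
(`B̃_α` the periodised Bernoulli polynomial, `periodizedBernoulli` of Mathlib) is continuous on
`𝕋ᵈ` with Fourier coefficients `f̂₀(𝐡) = ω_𝐡` (Mathlib's `fourierCoeff_bernoulli_eq` coordinate by
coordinate and Fubini), these are absolutely summable for `α ≥ 2`, so the lattice-rule error
formula `Q_{N,g}(f₀) - ∫ f₀ = Σ_{0 ≠ 𝐡 ∈ L⊥} f̂₀(𝐡)` (`hasSum_latticeRule_sub_integral`, Niederreiter
1992 eq. (5.4)) gives the node sum, since `∫ f₀ = f̂₀(0) = 1` and `Q_{N,g}(f₀) = (1/N) Σ_k ∏_i (1 +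
γ_i c_α B_α({k g_i/N}))`.  The sources take `γ_i > 0` (Dick–Pillichshammer) resp. `β_j ≥ 0`
(Lemieux); the identities hold verbatim for arbitrary real weights `γ_i`, which is how they are
stated here.  The restriction to even integers `α` is that of the sources (Remark 16, eq. (5.30)).

References (bib keys): J. Dick, F. Pillichshammer, in: A Panorama of Discrepancy Theory, LNM 2107
(2014) 539–619, doi:10.1007/978-3-319-04696-9_9 (`DickPillichshammer2014`); C. Lemieux, Monte
Carlo and quasi-Monte Carlo sampling, Springer (2009) (`Lemieux2009`); H. Niederreiter, Random
number generation and quasi-Monte Carlo methods, SIAM (1992) (`Niederreiter1992`).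

AI-produced formalisation (H21 engines group, seat eng-quad-1, 2026-08-20); no facts, no axioms
beyond Mathlib's, no `sorry`.
-/

open scoped Real Nat
open MeasureTheory Complex Finset UnitAddTorus

noncomputable section

namespace Literature.Analysis.Quadrature

attribute [local instance] latticeRules_measureSpace latticeRules_isAddHaarMeasure
  latticeRules_isProbabilityMeasure

variable {d : Type*} [Fintype d]

/-! ### The weights `ω_𝐡 = r_{α,γ}(𝐡)^{-1}` and the dual-lattice sum -/

/-- The product weights `ω_𝐡 = r_{α,γ}(𝐡)^{-1} = ∏_{i : h_i ≠ 0} γ_i / |h_i|^α` of the weighted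
Korobov space `H(K_{s,α,γ})` (`r_{α,γ}(0) = 1`, `r_{α,γ}(h) = γ^{-1} |h|^α` for `h ≠ 0`).
[cite: DickPillichshammer2014, Thm. 15] -/
def korobovWeight (α : ℕ) (γ : d → ℝ) (h : d → ℤ) : ℝ :=
  ∏ i, if h i = 0 then 1 else γ i / |(h i : ℝ)| ^ α

/-- The dual-lattice sum `Σ_{𝐡 ∈ L_{g,N} ∖ {0}} ω_𝐡` — by Theorem 15 the squared worst-case error
`e²(H(K_{s,α,γ}); P(g, N))` of the lattice rule `(g, N)` in the weighted Korobov space (the space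
itself is not formalised here), i.e. Lemieux's weighted `P̃_α` of eq. (5.29) with product weights
`β₀ = 1`, `γ_j = β_j^α`. [cite: DickPillichshammer2014, Thm. 15] -/
def weightedPFigure (α : ℕ) (γ : d → ℝ) (g : d → ℤ) (N : ℕ) : ℝ :=
  ∑' h : ((dualLattice N g : Set (d → ℤ)) \ {0} : Set (d → ℤ)), korobovWeight α γ h

/-- The constant `c_α = (-1)^{α/2+1} (2π)^α / α!` multiplying `B_α` in Remark 16 / eq. (5.30)
(for even `α`, `(-1)^{(α+2)/2} = (-1)^{α/2+1} = -(-1)^{α/2}`). [cite: DickPillichshammer2014, Rem. 16] -/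
def bernoulliCoeff (α : ℕ) : ℝ :=
  (-1) ^ (α / 2 + 1) * (2 * π) ^ α / α !

/-- `ω_0 = 1`. [cite: DickPillichshammer2014, Thm. 15] -/
theorem korobovWeight_zero (α : ℕ) (γ : d → ℝ) : korobovWeight α γ (0 : d → ℤ) = 1 := by
  classical
  simp [korobovWeight]

/-- For unit weights `γ = (1, 1, …)`, `ω_𝐡 = r(𝐡)^{-α}` with Niederreiter's `r(𝐡) = ∏ max(1, |h_j|)`
("in the unweighted case … we simply write `r_α`"). [cite: DickPillichshammer2014, Thm. 15] -/
theorem korobovWeight_one (α : ℕ) (h : d → ℤ) :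
    korobovWeight α (fun _ => 1) h = (rWeight h ^ (α : ℝ))⁻¹ := by
  rw [rWeight_rpow_inv_eq_prod, korobovWeight]
  refine Finset.prod_congr rfl fun j _ => ?_
  split_ifs with hj
  · simp [hj]
  · have h1 : (1 : ℝ) ≤ |(h j : ℝ)| := by exact_mod_cast Int.one_le_abs hj
    rw [max_eq_right h1, Real.rpow_natCast, one_div]

/-- `|ω_𝐡| ≤ (∏_i max(1, |γ_i|)) · r(𝐡)^{-α}`. [folklore] -/
private theorem abs_korobovWeight_le (α : ℕ) (γ : d → ℝ) (h : d → ℤ) :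
    |korobovWeight α γ h| ≤ (∏ i, max 1 |γ i|) * (rWeight h ^ (α : ℝ))⁻¹ := by
  rw [korobovWeight, Finset.abs_prod, rWeight_rpow_inv_eq_prod, ← Finset.prod_mul_distrib]
  refine Finset.prod_le_prod (fun i _ => abs_nonneg _) fun i _ => ?_
  split_ifs with hi
  · simp [hi]
  · have h1 : (1 : ℝ) ≤ |(h i : ℝ)| := by exact_mod_cast Int.one_le_abs hi
    rw [max_eq_right h1, Real.rpow_natCast, abs_div, abs_pow, abs_abs, div_eq_mul_inv]
    gcongr
    exact le_max_right _ _

/-- The series `Σ_{𝐡 ∈ ℤᵈ} ω_𝐡` converges absolutely for `α ≥ 2` ("weights … such that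
`Σ_𝐡 ω_𝐡 < ∞`"). [cite: DickPillichshammer2014, Thm. 15] -/
theorem summable_korobovWeight {α : ℕ} (hα : 2 ≤ α) (γ : d → ℝ) :
    Summable (korobovWeight α γ) := by
  have hk : (1 : ℝ) < (α : ℝ) := by exact_mod_cast hα
  refine Summable.of_norm_bounded
    ((summable_rWeight_rpow_inv (d := d) hk).mul_left (∏ i, max 1 |γ i|)) fun h => ?_
  rw [Real.norm_eq_abs]
  exact abs_korobovWeight_le α γ h

/-- **Theorem 15** (convergence of the right-hand side): for `α ≥ 2` the series
`Σ_{𝐡 ∈ L_{g,N} ∖ {0}} ω_𝐡` converges, to `weightedPFigure α γ g N`.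
[cite: DickPillichshammer2014, Thm. 15] -/
theorem hasSum_weightedPFigure {α : ℕ} (hα : 2 ≤ α) (γ : d → ℝ) (g : d → ℤ) (N : ℕ) :
    HasSum (fun h : ((dualLattice N g : Set (d → ℤ)) \ {0} : Set (d → ℤ)) =>
      korobovWeight α γ h) (weightedPFigure α γ g N) :=
  ((summable_korobovWeight hα γ).subtype _).hasSum

/-- With nonnegative weights the squared worst-case error is nonnegative.
[cite: DickPillichshammer2014, Thm. 15] -/
theorem weightedPFigure_nonneg (α : ℕ) {γ : d → ℝ} (hγ : ∀ i, 0 ≤ γ i) (g : d → ℤ) (N : ℕ) :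
    0 ≤ weightedPFigure α γ g N :=
  tsum_nonneg fun h => Finset.prod_nonneg fun i _ => by
    split_ifs
    · exact zero_le_one
    · exact div_nonneg (hγ i) (by positivity)

/-- In the unweighted case `γ = (1, 1, …)` the squared worst-case error is Niederreiter's
`P_α(g, N) = Σ_{0 ≠ 𝐡 ∈ L⊥} r(𝐡)^{-α}` (Niederreiter 1992, Def. 5.2).
[cite: DickPillichshammer2014, Thm. 15] -/
theorem pFigure_eq_weightedPFigure (α : ℕ) (g : d → ℤ) (N : ℕ) :
    pFigure (α : ℝ) g N = weightedPFigure α (fun _ => 1) g N := by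
  simp only [pFigure, weightedPFigure, korobovWeight_one]

/-! ### Remark 16, first display: the Fourier series of `B_α` for even `α` -/

/-- For even `α`, `-(2πi)^α / α! = c_α`. [cite: DickPillichshammer2014, Rem. 16] -/
private theorem neg_two_pi_I_pow_div_factorial {α : ℕ} (hα : Even α) :
    -(2 * (π : ℂ) * I) ^ α / (α ! : ℂ) = (bernoulliCoeff α : ℂ) := by
  have h2 : 2 * (α / 2) = α := Nat.two_mul_div_two_of_even hα
  have hI : I ^ α = (-1) ^ (α / 2) := by
    conv_lhs => rw [← h2]
    rw [pow_mul, I_sq]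
  simp only [bernoulliCoeff]
  push_cast
  rw [mul_pow, hI]
  ring

/-- **Remark 16, first display** ("see for example Sloan and Joe [106, Appendix C]"): for an even
integer `α ≥ 2` and `x ∈ [0, 1]`, `Σ_{h ∈ ℤ} e^{2πihx} / h^α = c_α B_α(x)` with
`c_α = (-1)^{α/2+1} (2π)^α / α!`, i.e. `B_α(x) = ((-1)^{(α+2)/2} α! / (2π)^α) Σ_{h ≠ 0} e^{2πihx} /
|h|^α` (`h^α = |h|^α` for even `α`; the term `h = 0` is `0` by the convention `1/0 = 0`).
[cite: DickPillichshammer2014, Rem. 16] -/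
theorem hasSum_fourier_div_pow {α : ℕ} (hα : Even α) (hα2 : 2 ≤ α) {x : ℝ}
    (hx : x ∈ Set.Icc (0 : ℝ) 1) :
    HasSum (fun h : ℤ => fourier h (x : UnitAddCircle) / (h : ℂ) ^ α)
      ((bernoulliCoeff α : ℂ) * bernoulliFun α x) := by
  have H := hasSum_one_div_pow_mul_fourier_mul_bernoulliFun hα2 hx
  have hf : (fun h : ℤ => fourier h (x : UnitAddCircle) / (h : ℂ) ^ α) =
      fun n : ℤ => 1 / (n : ℂ) ^ α * fourier n (x : UnitAddCircle) :=
    funext fun n => (one_div_mul_eq_div _ _).symm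
  rw [hf, ← neg_two_pi_I_pow_div_factorial hα]
  exact H

/-! ### The extremal function `f₀ = ∏_i (1 + γ_i c_α B̃_α(x_i))` and its Fourier coefficients -/

/-- The one-dimensional factor `F_{α,γ}(y) = 1 + γ c_α B̃_α(y)` on `ℝ/ℤ` (`B̃_α` the periodised
Bernoulli polynomial), as a complex-valued function. [cite: DickPillichshammer2014, Rem. 16] -/
private def factorFun (α : ℕ) (γ : ℝ) (y : UnitAddCircle) : ℂ :=
  1 + ((γ * bernoulliCoeff α : ℝ) : ℂ) * ((↑) ∘ periodizedBernoulli α : UnitAddCircle → ℂ) y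

/-- `F_{α,γ}` is continuous for `α ≠ 1`. [folklore] -/
private theorem continuous_factorFun {α : ℕ} (hα1 : α ≠ 1) (γ : ℝ) :
    Continuous (factorFun α γ) :=
  continuous_const.add (continuous_const.mul
    (continuous_ofReal.comp (periodizedBernoulli.continuous hα1)))

/-- The extremal ("worst-case") function `f₀(x) = ∏_i F_{α,γ_i}(x_i)` of the weighted Korobov
space, a continuous function on `𝕋ᵈ`. [cite: Niederreiter1992, Thm. 5.3] -/
private def extremalFun (α : ℕ) (hα1 : α ≠ 1) (γ : d → ℝ) : C(UnitAddTorus d, ℂ) where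
  toFun x := ∏ i, factorFun α (γ i) (x i)
  continuous_toFun :=
    continuous_finsetProd _ fun i _ => (continuous_factorFun hα1 (γ i)).comp (continuous_apply i)

/-- The algebra of Remark 16: `γ c_α · (-α! / (2πih)^α) = γ / |h|^α` for even `α` and `h ≠ 0`.
[cite: DickPillichshammer2014, Rem. 16] -/
private theorem bernoulliCoeff_mul_fourierCoeff {α : ℕ} (hα : Even α) (γ : ℝ) {n : ℤ}
    (hn : n ≠ 0) :
    ((γ * bernoulliCoeff α : ℝ) : ℂ) * (-(α ! : ℂ) / (2 * π * I * n) ^ α) =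
      ((γ / |(n : ℝ)| ^ α : ℝ) : ℂ) := by
  have h2 : 2 * (α / 2) = α := Nat.two_mul_div_two_of_even hα
  have hI : I ^ α = (-1) ^ (α / 2) := by
    conv_lhs => rw [← h2]
    rw [pow_mul, I_sq]
  rw [hα.pow_abs]
  simp only [bernoulliCoeff]
  push_cast
  rw [show (2 * (π : ℂ) * I * n) ^ α = (2 * π) ^ α * (-1) ^ (α / 2) * (n : ℂ) ^ α by
    rw [mul_pow, mul_pow, hI]]
  have hπ : (π : ℂ) ≠ 0 := ofReal_ne_zero.mpr Real.pi_ne_zero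
  have hn' : (n : ℂ) ≠ 0 := Int.cast_ne_zero.mpr hn
  have hf : (α ! : ℂ) ≠ 0 := Nat.cast_ne_zero.mpr (Nat.factorial_ne_zero α)
  have h1 : ((-1 : ℂ)) ^ (α / 2) ≠ 0 := pow_ne_zero _ (neg_ne_zero.mpr one_ne_zero)
  field_simp
  ring

/-- An integrable-by-continuity helper on the compact group `ℝ/ℤ`. [folklore] -/
private theorem integrable_haarAddCircle_of_continuous {F : UnitAddCircle → ℂ} (hF : Continuous F) :
    Integrable F AddCircle.haarAddCircle :=
  hF.integrable_of_hasCompactSupport (HasCompactSupport.of_compactSpace F)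

/-- The Fourier coefficients of the factor: `F̂_{α,γ}(0) = 1` and `F̂_{α,γ}(h) = γ / |h|^α` for
`h ≠ 0` (even `α ≥ 2`), by the Fourier expansion of `B_α`. [cite: DickPillichshammer2014, Rem. 16] -/
private theorem fourierCoeff_factorFun {α : ℕ} (hα : Even α) (hα0 : α ≠ 0) (γ : ℝ) (n : ℤ) :
    fourierCoeff (factorFun α γ) n =
      ((if n = 0 then (1 : ℝ) else γ / |(n : ℝ)| ^ α : ℝ) : ℂ) := by
  have hα1 : α ≠ 1 := fun h => Nat.not_even_one (h ▸ hα)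
  have hB : Continuous ((↑) ∘ periodizedBernoulli α : UnitAddCircle → ℂ) :=
    continuous_ofReal.comp (periodizedBernoulli.continuous hα1)
  have hi1 : Integrable (fun _ : UnitAddCircle => (1 : ℂ)) AddCircle.haarAddCircle :=
    integrable_const _
  have hi2 : Integrable (fun y => ((γ * bernoulliCoeff α : ℝ) : ℂ) *
      ((↑) ∘ periodizedBernoulli α : UnitAddCircle → ℂ) y) AddCircle.haarAddCircle :=
    integrable_haarAddCircle_of_continuous (continuous_const.mul hB)
  have hsplit : factorFun α γ = (fun _ : UnitAddCircle => (1 : ℂ)) + fun y =>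
      ((γ * bernoulliCoeff α : ℝ) : ℂ) * ((↑) ∘ periodizedBernoulli α : UnitAddCircle → ℂ) y :=
    rfl
  have h0 : (fun _ : UnitAddCircle => (1 : ℂ)) = ⇑(@fourier 1 0) := by
    ext y
    exact fourier_zero.symm
  rw [hsplit, fourierCoeff.add hi1 hi2, Pi.add_apply, fourierCoeff.const_mul,
    fourierCoeff_bernoulli_eq hα0, h0, fourierCoeff_fourier]
  by_cases hn : n = 0
  · subst hn
    simp [hα0]
  · rw [Pi.single_eq_of_ne hn, if_neg hn, zero_add]
    exact bernoulliCoeff_mul_fourierCoeff hα γ hn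

/-- **`f̂₀(𝐡) = ω_𝐡`**: the Fourier coefficients of the extremal function are the weights
(Fubini, coordinate by coordinate). [cite: DickPillichshammer2014, Rem. 16] -/
private theorem mFourierCoeff_extremalFun {α : ℕ} (hα : Even α) (hα0 : α ≠ 0) (hα1 : α ≠ 1)
    (γ : d → ℝ) (h : d → ℤ) :
    mFourierCoeff (extremalFun α hα1 γ) h = (korobovWeight α γ h : ℂ) := by
  have key : mFourierCoeff (extremalFun α hα1 γ) h =
      ∏ i, fourierCoeff (factorFun α (γ i)) (h i) := by
    simp only [mFourierCoeff, extremalFun, mFourier, ContinuousMap.coe_mk, Pi.neg_apply,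
      smul_eq_mul, ← Finset.prod_mul_distrib]
    rw [MeasureTheory.integral_fintype_prod_volume_eq_prod (𝕜 := ℂ)
      (f := fun (i : d) (y : UnitAddCircle) => fourier (-(h i)) y * factorFun α (γ i) y)]
    rfl
  rw [key, korobovWeight, ofReal_prod]
  exact Finset.prod_congr rfl fun i _ => fourierCoeff_factorFun hα hα0 (γ i) (h i)

/-- `∫_{𝕋ᵈ} f₀ = f̂₀(0) = 1`. [cite: DickPillichshammer2014, Rem. 16] -/
private theorem integral_extremalFun {α : ℕ} (hα : Even α) (hα0 : α ≠ 0) (hα1 : α ≠ 1)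
    (γ : d → ℝ) : ∫ x, extremalFun α hα1 γ x = 1 := by
  rw [← mFourierCoeff_zero, mFourierCoeff_extremalFun hα hα0 hα1, korobovWeight_zero, ofReal_one]

/-! ### The lattice rule applied to `f₀`: the Bernoulli node sum -/

/-- `B̃_α(x mod 1) = B_α({x})`. [folklore] -/
private theorem periodizedBernoulli_coe (k : ℕ) (x : ℝ) :
    periodizedBernoulli k (x : UnitAddCircle) = bernoulliFun k (Int.fract x) := by
  have hx : ((x : ℝ) : UnitAddCircle) = ((Int.fract x : ℝ) : UnitAddCircle) := by
    rw [← sub_eq_zero, ← AddCircle.coe_sub, Int.self_sub_fract, AddCircle.coe_eq_zero_iff]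
    exact ⟨⌊x⌋, by simp⟩
  rw [hx, periodizedBernoulli, AddCircle.liftIco_zero_coe_apply]
  exact ⟨Int.fract_nonneg x, Int.fract_lt_one x⟩

omit [Fintype d] in
/-- The factor at a lattice node: `F_{α,γ_j}((x_i)_j) = 1 + γ_j c_α B_α({k g_j / N})` for the
representative `k = i.val` of `i ∈ ℤ/Nℤ`. [cite: DickPillichshammer2014, Rem. 16] -/
private theorem factorFun_latticeNode (α : ℕ) (γ : d → ℝ) (g : d → ℤ) (N : ℕ) [NeZero N]
    (i : ZMod N) (j : d) :
    factorFun α (γ j) (latticeNode N g i j) = ((1 + γ j * (bernoulliCoeff α *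
      bernoulliFun α (Int.fract ((((i.val : ℤ) * g j : ℤ) : ℝ) / N))) : ℝ) : ℂ) := by
  have hnode : latticeNode N g i j = (((((i.val : ℤ) * g j : ℤ) : ℝ) / N : ℝ) : UnitAddCircle) := by
    have := latticeNode_intCast N g (i.val : ℤ) j
    rwa [Int.cast_natCast, ZMod.natCast_zmod_val] at this
  rw [hnode, factorFun, Function.comp_apply, periodizedBernoulli_coe]
  push_cast
  ring

/-- `Q_{N,g}(f₀) = (1/N) Σ_{i ∈ ℤ/Nℤ} ∏_j (1 + γ_j c_α B_α({i g_j / N}))`.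
[cite: DickPillichshammer2014, Rem. 16] -/
private theorem latticeRule_extremalFun {α : ℕ} (hα1 : α ≠ 1) (γ : d → ℝ) (g : d → ℤ) (N : ℕ)
    [NeZero N] :
    latticeRule N g (extremalFun α hα1 γ) = (((N : ℝ)⁻¹ * ∑ i : ZMod N, ∏ j, (1 + γ j *
      (bernoulliCoeff α * bernoulliFun α (Int.fract ((((i.val : ℤ) * g j : ℤ) : ℝ) / N)))) : ℝ) :
        ℂ) := by
  simp only [latticeRule, qmcAverage, ZMod.card, extremalFun, ContinuousMap.coe_mk,
    factorFun_latticeNode, Complex.real_smul]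
  push_cast
  rfl

/-- The error formula applied to `f₀`: `Σ_{0 ≠ 𝐡 ∈ L⊥} ω_𝐡 = Q_{N,g}(f₀) - ∫ f₀` (in `ℂ`).
[cite: DickPillichshammer2014, Thm. 15] -/
private theorem hasSum_korobovWeight_complex {α : ℕ} (hα : Even α) (hα0 : α ≠ 0) (hα1 : α ≠ 1)
    (γ : d → ℝ) (g : d → ℤ) (N : ℕ) [NeZero N] :
    HasSum (fun h : ((dualLattice N g : Set (d → ℤ)) \ {0} : Set (d → ℤ)) =>
      (korobovWeight α γ h : ℂ))
      (latticeRule N g (extremalFun α hα1 γ) - ∫ x, extremalFun α hα1 γ x) := by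
  have hα2 : 2 ≤ α := by
    obtain ⟨m, hm⟩ := hα
    omega
  have hsum : Summable (mFourierCoeff (extremalFun α hα1 γ)) := by
    have : mFourierCoeff (extremalFun α hα1 γ) = fun h => (korobovWeight α γ h : ℂ) :=
      funext (mFourierCoeff_extremalFun hα hα0 hα1 γ)
    rw [this]
    exact Complex.summable_ofReal.mpr (summable_korobovWeight hα2 γ)
  simpa only [mFourierCoeff_extremalFun hα hα0 hα1] using hasSum_latticeRule_sub_integral N g hsum

/-! ### Remark 16 / Lemieux (5.30): the Bernoulli-polynomial formula -/

/-- **Remark 16 (second display)**, `HasSum` form: for an even integer `α ≥ 2`, every generating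
vector `g` and `N ≥ 1`, `Σ_{𝐡 ∈ L_{g,N} ∖ {0}} ω_𝐡 = -1 + (1/N) Σ_{i ∈ ℤ/Nℤ} ∏_j (1 + γ_j
((-1)^{(α+2)/2} (2π)^α / α!) B_α({i g_j / N}))`. [cite: DickPillichshammer2014, Rem. 16] -/
theorem hasSum_korobovWeight_dualLattice {α : ℕ} (hα : Even α) (hα0 : α ≠ 0) (γ : d → ℝ)
    (g : d → ℤ) (N : ℕ) [NeZero N] :
    HasSum (fun h : ((dualLattice N g : Set (d → ℤ)) \ {0} : Set (d → ℤ)) => korobovWeight α γ h)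
      (-1 + (N : ℝ)⁻¹ * ∑ i : ZMod N, ∏ j, (1 + γ j *
        (bernoulliCoeff α * bernoulliFun α (Int.fract ((((i.val : ℤ) * g j : ℤ) : ℝ) / N))))) := by
  have hα1 : α ≠ 1 := fun h => Nat.not_even_one (h ▸ hα)
  have H := hasSum_korobovWeight_complex hα hα0 hα1 γ g N
  rw [latticeRule_extremalFun hα1, integral_extremalFun hα hα0 hα1, ← ofReal_one, ← ofReal_sub]
    at H
  rw [neg_add_eq_sub]
  exact Complex.hasSum_ofReal.mp H

/-- **Remark 16 (second display) / Lemieux eq. (5.30)**: for an even integer `α ≥ 2`,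
`e²(H(K_{s,α,γ}); P(g, N)) = -1 + (1/N) Σ_{i ∈ ℤ/Nℤ} ∏_j (1 + γ_j c_α B_α({i g_j / N}))`,
`c_α = (-1)^{(α+2)/2} (2π)^α / α!`. [cite: DickPillichshammer2014, Rem. 16] -/
theorem weightedPFigure_eq_bernoulli_sum {α : ℕ} (hα : Even α) (hα0 : α ≠ 0) (γ : d → ℝ)
    (g : d → ℤ) (N : ℕ) [NeZero N] :
    weightedPFigure α γ g N = -1 + (N : ℝ)⁻¹ * ∑ i : ZMod N, ∏ j, (1 + γ j *
      (bernoulliCoeff α * bernoulliFun α (Int.fract ((((i.val : ℤ) * g j : ℤ) : ℝ) / N)))) :=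
  (hasSum_korobovWeight_dualLattice hα hα0 γ g N).tsum_eq

/-- Re-indexing a sum over `ℤ/Nℤ` by the representatives `0, …, N - 1`. [folklore] -/
private theorem sum_zmod_val_eq_sum_range {M : Type*} [AddCommMonoid M] (N : ℕ) [NeZero N]
    (F : ℕ → M) : ∑ i : ZMod N, F i.val = ∑ k ∈ Finset.range N, F k := by
  obtain ⟨n, rfl⟩ := Nat.exists_eq_succ_of_ne_zero (NeZero.ne N)
  exact Fin.sum_univ_eq_sum_range F (n + 1)

/-- **Lemieux eq. (5.30)** (= Remark 16 with the nodes written `u_i = {i g / n}`, `i = 0, …,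
n - 1`): for an even integer `α ≥ 2`, `P̃_α = -1 + (1/n) Σ_{i=0}^{n-1} ∏_{j=1}^{s} [1 + γ_j c_α
B_α(u_{ij})]` with `γ_j c_α = -(-β_j²)^{α/2} (2π)^α / α!` for `γ_j = β_j^α`; "the compact
formulation (5.30) is used when this criterion is computed in practice", in `O(n s)` operations.
[cite: Lemieux2009, eq. (5.30)] -/
theorem weightedPFigure_eq_bernoulli_sum_range {α : ℕ} (hα : Even α) (hα0 : α ≠ 0) (γ : d → ℝ)
    (g : d → ℤ) (N : ℕ) [NeZero N] :
    weightedPFigure α γ g N = -1 + (N : ℝ)⁻¹ * ∑ k ∈ Finset.range N, ∏ j, (1 + γ j *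
      (bernoulliCoeff α * bernoulliFun α (Int.fract ((((k : ℤ) * g j : ℤ) : ℝ) / N)))) := by
  rw [weightedPFigure_eq_bernoulli_sum hα hα0,
    ← sum_zmod_val_eq_sum_range N fun k => ∏ j, (1 + γ j *
      (bernoulliCoeff α * bernoulliFun α (Int.fract ((((k : ℤ) * g j : ℤ) : ℝ) / N))))]

/-- Niederreiter's `P_α(g, N)` for an even integer `α ≥ 2` as a node sum:
`P_α(g, N) = -1 + (1/N) Σ_{k=0}^{N-1} ∏_j (1 + c_α B_α({k g_j / N}))` (Remark 16 with unit
weights). [cite: DickPillichshammer2014, Rem. 16] -/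
theorem pFigure_eq_bernoulli_sum {α : ℕ} (hα : Even α) (hα0 : α ≠ 0) (g : d → ℤ) (N : ℕ)
    [NeZero N] :
    pFigure (α : ℝ) g N = -1 + (N : ℝ)⁻¹ * ∑ k ∈ Finset.range N, ∏ j,
      (1 + bernoulliCoeff α * bernoulliFun α (Int.fract ((((k : ℤ) * g j : ℤ) : ℝ) / N))) := by
  rw [pFigure_eq_weightedPFigure, weightedPFigure_eq_bernoulli_sum_range hα hα0]
  simp only [one_mul]

/-- `c_2 = 2π²`. [cite: DickPillichshammer2014, Rem. 16] -/
theorem bernoulliCoeff_two : bernoulliCoeff 2 = 2 * π ^ 2 := by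
  rw [bernoulliCoeff, Nat.factorial_two]
  norm_num
  ring

/-- The case `α = 2` of Remark 16 / eq. (5.30), with `B₂(u) = u² - u + 1/6`:
`e²(H(K_{s,2,γ}); P(g, N)) = -1 + (1/N) Σ_{k=0}^{N-1} ∏_j (1 + γ_j 2π² ({k g_j/N}² - {k g_j/N} +
1/6))` — the quantity minimised by component-by-component searches in practice.
[cite: Lemieux2009, eq. (5.30)] -/
theorem weightedPFigure_two (γ : d → ℝ) (g : d → ℤ) (N : ℕ) [NeZero N] :
    weightedPFigure 2 γ g N = -1 + (N : ℝ)⁻¹ * ∑ k ∈ Finset.range N, ∏ j,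
      (1 + γ j * (2 * π ^ 2 * (Int.fract ((((k : ℤ) * g j : ℤ) : ℝ) / N) ^ 2 -
        Int.fract ((((k : ℤ) * g j : ℤ) : ℝ) / N) + 6⁻¹))) := by
  rw [weightedPFigure_eq_bernoulli_sum_range even_two two_ne_zero]
  simp only [bernoulliCoeff_two, bernoulliFun_two]

/-- The case `α = 2` for Niederreiter's `P_2(g, N)`:
`P_2(g, N) = -1 + (1/N) Σ_{k=0}^{N-1} ∏_j (1 + 2π² ({k g_j/N}² - {k g_j/N} + 1/6))`.
[cite: Lemieux2009, eq. (5.30)] -/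
theorem pFigure_two (g : d → ℤ) (N : ℕ) [NeZero N] :
    pFigure 2 g N = -1 + (N : ℝ)⁻¹ * ∑ k ∈ Finset.range N, ∏ j,
      (1 + 2 * π ^ 2 * (Int.fract ((((k : ℤ) * g j : ℤ) : ℝ) / N) ^ 2 -
        Int.fract ((((k : ℤ) * g j : ℤ) : ℝ) / N) + 6⁻¹)) := by
  have h := pFigure_eq_bernoulli_sum (d := d) even_two two_ne_zero g N
  simp only [Nat.cast_ofNat, bernoulliCoeff_two, bernoulliFun_two] at h
  exact h

/-! ### Niederreiter 1992, Theorem 5.3: the bound `C P_α(g, N)` is attained -/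

/-- Fourier coefficients commute with real scalars. [folklore] -/
private theorem mFourierCoeff_real_smul (c : ℝ) (f : UnitAddTorus d → ℂ) (h : d → ℤ) :
    mFourierCoeff (c • f) h = c • mFourierCoeff f h := by
  simp only [mFourierCoeff, Pi.smul_apply]
  rw [← integral_smul]
  congr 1 with t
  exact smul_comm _ _ _

omit [Fintype d] in
/-- Lattice rules commute with real scalars. [folklore] -/
private theorem latticeRule_real_smul (N : ℕ) [NeZero N] (g : d → ℤ) (c : ℝ)
    (f : UnitAddTorus d → ℂ) : latticeRule N g (c • f) = c • latticeRule N g f := by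
  simp only [latticeRule, qmcAverage, Pi.smul_apply, Finset.smul_sum, smul_smul, mul_comm c]

/-- **Theorem 5.3 (attainment of the bound)**: for an even integer `α ≥ 2`, `C ≥ 0`, any
`g ∈ ℤᵈ` and `N ≥ 1` there is `f₀ ∈ E^d_α(C)` — namely `f₀ = C Σ_𝐡 r(𝐡)^{-α} e(𝐡 · u) = C ∏_i (1 +
c_α B_α({u_i}))` — with `(1/N) Σ_{n=0}^{N-1} f₀((n/N) g) - ∫ f₀ = C P_α(g, N)`; together with the
bound `≤ C P_α(g, N)` valid for every `f ∈ E^d_α(C)` (`norm_latticeRule_sub_integral_le_mul_pFigure`)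
this is `max_{f ∈ E^d_α(C)} |Q_{N,g}(f) - ∫ f| = C P_α(g, N)`.  (The source proves this for every
real `α > 1`; the present formalisation covers the even integers `α`, where `f₀` has the closed
form above.) [cite: Niederreiter1992, Thm. 5.3] -/
theorem exists_mem_korobovClass_latticeRule_sub_integral_eq {α : ℕ} (hα : Even α) (hα0 : α ≠ 0)
    {C : ℝ} (hC : 0 ≤ C) (g : d → ℤ) (N : ℕ) [NeZero N] :
    ∃ f ∈ KorobovClass d α C,
      latticeRule N g f - ∫ x, f x = ((C * pFigure (α : ℝ) g N : ℝ) : ℂ) := by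
  have hα1 : α ≠ 1 := fun h => Nat.not_even_one (h ▸ hα)
  have hα2 : 2 ≤ α := by
    obtain ⟨m, hm⟩ := hα
    omega
  set f₀ : C(UnitAddTorus d, ℂ) := extremalFun α hα1 (fun _ => 1) with hf₀
  refine ⟨C • f₀, ?_, ?_⟩
  · rw [mem_korobovClass]
    intro h _
    rw [ContinuousMap.coe_smul, mFourierCoeff_real_smul, mFourierCoeff_extremalFun hα hα0 hα1,
      korobovWeight_one, norm_smul, Real.norm_eq_abs, abs_of_nonneg hC, Complex.norm_real,
      Real.norm_eq_abs, abs_of_nonneg (inv_nonneg.mpr (Real.rpow_nonneg (rWeight_pos h).le _))]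
  · have herr : latticeRule N g f₀ - ∫ x, f₀ x = (pFigure (α : ℝ) g N : ℂ) := by
      rw [pFigure_eq_weightedPFigure]
      exact (hasSum_korobovWeight_complex hα hα0 hα1 (fun _ => 1) g N).unique
        (Complex.hasSum_ofReal.mpr (hasSum_weightedPFigure hα2 (fun _ : d => (1 : ℝ)) g N))
    rw [ContinuousMap.coe_smul, latticeRule_real_smul]
    simp only [Pi.smul_apply]
    rw [integral_smul, ← smul_sub, herr, Complex.real_smul, ofReal_mul]

end Literature.Analysis.Quadrature

end
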